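import Mathlib.Analysis.SpecialFunctions.Log.Basic
import Mathlib.Analysis.SpecialFunctions.Pow.Real
import Mathlib.Analysis.Complex.Exponential
import Mathlib.Algebra.Ring.GeomSum
import HarnessLib

/-!
# From a power saving for logarithmic Riesz means to a power saving for partial sums
(non-negative coefficients; the differencing argument)

Topic `Analysis/Complex` (Perron machinery), namespace `Literature.Analysis.Complex`. Proof file
(theorems only; no definition, no named fact). For a sequence `Cₙ ≥ 0` write
`S_j(x) = Σ_{n ≤ x} Cₙ (log x/n)ʲ/j!` (the logarithmic Riesz mean of order `j`, `S₀ = Σ_{n ≤ x} Cₙ`).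
Since `(log(x/n) + δ)₊ʲ/j! - (log x/n)₊ʲ/j!` lies between `δ (log x/n)₊^{j-1}/(j-1)!` and
`δ (log x/n + δ)₊^{j-1}/(j-1)!`, one has `δ S_{j-1}(x) ≤ S_j(x e^δ) - S_j(x) ≤ δ S_{j-1}(x e^δ)`
(`riesz_diff_bounds`), and an asymptotic `S_j(x) = c x^κ + O(x^θ)` (`θ < κ`, `c ≥ 0`) descends to
`S_{j-1}(x) = κ c x^κ + O(x^{(κ+θ)/2})` by the choice `δ = x^{-(κ-θ)/2}` (`riesz_descent`); by
induction (`riesz_descent_iter`) a power saving for `S_m` gives one for `S₀`, and then for the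
coefficients themselves, `Cₙ ≤ K n^{θ₀}` (`coeff_le_of_partialSum`). This is the classical
passage from smoothed to sharp sums for monotone counting functions (e.g. Montgomery–Vaughan,
*Multiplicative Number Theory I*, §5.1, Exercise-level; Landau). Here `κ = 2` is fixed, the case
used by the Rankin–Selberg application (`Literature.NumberTheory.Automorphic`).

## References

* H. L. Montgomery, R. C. Vaughan, *Multiplicative Number Theory I*, CUP 2007, §5.1.
-/

noncomputable section

open Real Finset

namespace Literature.Analysis.Complex

/-! ### The kernels `p_j(u) = u₊ʲ/j!` (`j ≥ 1`), `p₀ = 𝟙_{u ≥ 0}` -/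

/-- `v^j - u^j ≤ j v^{j-1} (v - u)` for `0 ≤ u ≤ v`. [folklore] -/
theorem pow_sub_pow_le_mul {u v : ℝ} (hu : 0 ≤ u) (huv : u ≤ v) (j : ℕ) :
    v ^ j - u ^ j ≤ j * v ^ (j - 1) * (v - u) := by
  rcases Nat.eq_zero_or_pos j with rfl | hj
  · simp
  · have h := geom_sum₂_mul v u j
    rw [← h]
    have hsum : ∑ i ∈ range j, v ^ i * u ^ (j - 1 - i) ≤ ∑ _i ∈ range j, v ^ (j - 1) := by
      refine Finset.sum_le_sum fun i hi ↦ ?_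
      have hi' : i ≤ j - 1 := by have := Finset.mem_range.mp hi; omega
      calc v ^ i * u ^ (j - 1 - i) ≤ v ^ i * v ^ (j - 1 - i) :=
            mul_le_mul_of_nonneg_left (pow_le_pow_left₀ hu huv _) (pow_nonneg (hu.trans huv) _)
        _ = v ^ (j - 1) := by rw [← pow_add]; congr 1; omega
    rw [Finset.sum_const, Finset.card_range, nsmul_eq_mul] at hsum
    have hvu : 0 ≤ v - u := by linarith
    calc (∑ i ∈ range j, v ^ i * u ^ (j - 1 - i)) * (v - u) ≤ (j * v ^ (j - 1)) * (v - u) :=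
          mul_le_mul_of_nonneg_right hsum hvu
      _ = j * v ^ (j - 1) * (v - u) := by ring

/-- `j u^{j-1} (v - u) ≤ v^j - u^j` for `0 ≤ u ≤ v`. [folklore] -/
theorem mul_le_pow_sub_pow {u v : ℝ} (hu : 0 ≤ u) (huv : u ≤ v) (j : ℕ) :
    j * u ^ (j - 1) * (v - u) ≤ v ^ j - u ^ j := by
  rcases Nat.eq_zero_or_pos j with rfl | hj
  · simp
  · have h := geom_sum₂_mul v u j
    rw [← h]
    have hsum : ∑ _i ∈ range j, u ^ (j - 1) ≤ ∑ i ∈ range j, v ^ i * u ^ (j - 1 - i) := by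
      refine Finset.sum_le_sum fun i hi ↦ ?_
      have hi' : i ≤ j - 1 := by have := Finset.mem_range.mp hi; omega
      calc u ^ (j - 1) = u ^ i * u ^ (j - 1 - i) := by rw [← pow_add]; congr 1; omega
        _ ≤ v ^ i * u ^ (j - 1 - i) :=
            mul_le_mul_of_nonneg_right (pow_le_pow_left₀ hu huv _) (pow_nonneg hu _)
    rw [Finset.sum_const, Finset.card_range, nsmul_eq_mul] at hsum
    have hvu : 0 ≤ v - u := by linarith
    calc (j : ℝ) * u ^ (j - 1) * (v - u) = (j * u ^ (j - 1)) * (v - u) := by ring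
      _ ≤ (∑ i ∈ range j, v ^ i * u ^ (j - 1 - i)) * (v - u) := mul_le_mul_of_nonneg_right hsum hvu

/-- **The kernel increments.** With `p_j(u) = (max u 0)ʲ/j!` for `j ≥ 1` and
`p₀(u) = 𝟙_{u ≥ 0}`, for every `j ≥ 1`, `u ∈ ℝ` and `δ > 0`:
`δ p_{j-1}(u) ≤ p_j(u + δ) - p_j(u) ≤ δ p_{j-1}(u + δ)`. [folklore] -/
theorem kernel_diff_bounds (j : ℕ) (hj : 1 ≤ j) (u : ℝ) {δ : ℝ} (hδ : 0 < δ) :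
    δ * (if j - 1 = 0 then (if 0 ≤ u then 1 else 0) else (max u 0) ^ (j - 1) / (j - 1).factorial) ≤
        (max (u + δ) 0) ^ j / j.factorial - (max u 0) ^ j / j.factorial ∧
      (max (u + δ) 0) ^ j / j.factorial - (max u 0) ^ j / j.factorial ≤
        δ * (if j - 1 = 0 then (if 0 ≤ u + δ then 1 else 0) else (max (u + δ) 0) ^ (j - 1) / (j - 1).factorial) := by
  have hjf : (0 : ℝ) < j.factorial := by positivity
  have hfac : (j.factorial : ℝ) = j * (j - 1).factorial := by
    rw [← Nat.mul_factorial_pred (by omega : j ≠ 0)]; push_cast; ring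
  -- `v = (u+δ)₊`, `u' = u₊`, `0 ≤ u' ≤ v`, `v - u' ≤ δ`
  set v : ℝ := max (u + δ) 0 with hv
  set u' : ℝ := max u 0 with hu'
  have hu'0 : 0 ≤ u' := le_max_right _ _
  have hv0 : 0 ≤ v := le_max_right _ _
  have hu'v : u' ≤ v := max_le_max (by linarith) le_rfl
  have hvu' : v - u' ≤ δ := by
    simp only [hv, hu']
    rcases le_or_gt 0 u with h | h
    · rw [max_eq_left (by linarith), max_eq_left h]; linarith
    · rw [max_eq_right h.le]
      rcases le_or_gt 0 (u + δ) with h' | h'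
      · rw [max_eq_left h']; linarith
      · rw [max_eq_right h'.le]; linarith
  rw [div_sub_div_same]
  constructor
  · -- lower bound
    by_cases hj1 : j - 1 = 0
    · rw [if_pos hj1]
      have hjeq : j = 1 := by omega
      subst hjeq
      simp only [pow_one, Nat.factorial_one, Nat.cast_one, div_one]
      split_ifs with h0
      · simp only [hv, hu']
        rw [max_eq_left (by linarith), max_eq_left h0]; linarith
      · push Not at h0
        simp only [hv, hu']
        rw [max_eq_right h0.le, mul_zero]
        linarith [le_max_right (u + δ) 0]
    · rw [if_neg hj1]
      by_cases h0 : 0 ≤ u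
      · -- `u ≥ 0`: `j u^{j-1} δ ≤ v^j - u^j`
        have hu'eq : u' = u := max_eq_left h0
        have hveq : v = u + δ := max_eq_left (by linarith)
        have key := mul_le_pow_sub_pow hu'0 hu'v j
        rw [le_div_iff₀ hjf, hfac]
        have : δ * (u' ^ (j - 1) / ((j - 1).factorial)) * (j * (j - 1).factorial) =
            j * u' ^ (j - 1) * δ := by field_simp
        rw [hu'eq] at this key hu'v ⊢
        rw [this]
        have hδ' : δ = v - u := by rw [hveq]; ring
        rw [hδ']
        convert key using 2
      · -- `u < 0`: the left side vanishes
        push Not at h0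
        have hu'eq : u' = 0 := max_eq_right h0.le
        rw [hu'eq, zero_pow hj1, zero_div, mul_zero, zero_pow (by omega), sub_zero]
        positivity
  · -- upper bound
    by_cases hj1 : j - 1 = 0
    · rw [if_pos hj1]
      have hjeq : j = 1 := by omega
      subst hjeq
      simp only [pow_one, Nat.factorial_one, Nat.cast_one, div_one]
      split_ifs with h0
      · rw [mul_one]; linarith
      · push Not at h0
        have hveq : v = 0 := max_eq_right h0.le
        rw [hveq, mul_zero]
        linarith
    · rw [if_neg hj1]
      have key := pow_sub_pow_le_mul hu'0 hu'v j
      rw [div_le_iff₀ hjf, hfac]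
      have : δ * (v ^ (j - 1) / ((j - 1).factorial)) * (j * (j - 1).factorial) = j * v ^ (j - 1) * δ := by
        field_simp
      rw [this]
      refine key.trans ?_
      exact mul_le_mul_of_nonneg_left hvu' (by positivity)

/-! ### Sums `S_q(x) = Σ_{n ≤ x} Cₙ q(log x/n)` for a kernel supported in `[0, ∞)` -/

section Sums

variable {C : ℕ → ℝ} {q Q : ℝ → ℝ}

/-- Extending the range: if `q = 0` on `(-∞, 0)`, then for `N ≥ ⌊x⌋` the sum over `n ≤ x` equals
the sum over `n ≤ N` (`log(x/n) < 0` for `n > x`). [folklore] -/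
theorem sum_Icc_floor_eq_sum_Icc (hq : ∀ u, u < 0 → q u = 0) {x : ℝ} (hx : 0 < x) {N : ℕ} (hN : ⌊x⌋₊ ≤ N) :
    ∑ n ∈ Icc 1 ⌊x⌋₊, C n * q (Real.log (x / n)) = ∑ n ∈ Icc 1 N, C n * q (Real.log (x / n)) := by
  refine (Finset.sum_subset (fun n hn ↦ ?_) (fun n hn hn' ↦ ?_)).trans rfl
  · rw [Finset.mem_Icc] at hn ⊢; exact ⟨hn.1, hn.2.trans hN⟩
  · rw [Finset.mem_Icc] at hn hn'
    have hnx : x < n := by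
      have : ⌊x⌋₊ < n := by omega
      exact (Nat.floor_lt hx.le).mp this
    have hn0 : (0 : ℝ) < n := by exact_mod_cast hn.1
    rw [hq _ (Real.log_neg (by positivity) ((div_lt_one hn0).mpr hnx)), mul_zero]

/-- **The difference inequalities for the Riesz sums**: if `Cₙ ≥ 0`, `q, Q` vanish on `(-∞, 0)`
and `δ q(u) ≤ Q(u+δ) - Q(u) ≤ δ q(u+δ)` (`δ > 0`), then
`δ S_q(x) ≤ S_Q(x e^δ) - S_Q(x) ≤ δ S_q(x e^δ)` (`x > 0`). [folklore] -/
theorem riesz_diff_bounds (hC : ∀ n, 0 ≤ C n) (hq : ∀ u, u < 0 → q u = 0) (hQ : ∀ u, u < 0 → Q u = 0)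
    (hker : ∀ u : ℝ, ∀ δ : ℝ, 0 < δ → δ * q u ≤ Q (u + δ) - Q u ∧ Q (u + δ) - Q u ≤ δ * q (u + δ))
    {x δ : ℝ} (hx : 0 < x) (hδ : 0 < δ) :
    δ * ∑ n ∈ Icc 1 ⌊x⌋₊, C n * q (Real.log (x / n)) ≤
        (∑ n ∈ Icc 1 ⌊x * Real.exp δ⌋₊, C n * Q (Real.log (x * Real.exp δ / n))) -
          ∑ n ∈ Icc 1 ⌊x⌋₊, C n * Q (Real.log (x / n)) ∧
      (∑ n ∈ Icc 1 ⌊x * Real.exp δ⌋₊, C n * Q (Real.log (x * Real.exp δ / n))) -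
          ∑ n ∈ Icc 1 ⌊x⌋₊, C n * Q (Real.log (x / n)) ≤
        δ * ∑ n ∈ Icc 1 ⌊x * Real.exp δ⌋₊, C n * q (Real.log (x * Real.exp δ / n)) := by
  have hxe : x ≤ x * Real.exp δ := le_mul_of_one_le_right hx.le (Real.one_le_exp hδ.le)
  have hN : ⌊x⌋₊ ≤ ⌊x * Real.exp δ⌋₊ := Nat.floor_le_floor hxe
  rw [sum_Icc_floor_eq_sum_Icc hq hx hN, sum_Icc_floor_eq_sum_Icc hQ hx hN, Finset.mul_sum, Finset.mul_sum,
    ← Finset.sum_sub_distrib]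
  have hlog : ∀ n ∈ Icc 1 ⌊x * Real.exp δ⌋₊, Real.log (x * Real.exp δ / n) = Real.log (x / n) + δ := by
    intro n hn
    have hn0 : (0 : ℝ) < n := by exact_mod_cast (Finset.mem_Icc.mp hn).1
    rw [mul_div_right_comm, Real.log_mul (by positivity) (Real.exp_pos δ).ne', Real.log_exp]
  constructor
  · refine Finset.sum_le_sum fun n hn ↦ ?_
    rw [hlog n hn, ← mul_sub, mul_left_comm]
    exact mul_le_mul_of_nonneg_left (hker _ δ hδ).1 (hC n)
  · refine Finset.sum_le_sum fun n hn ↦ ?_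
    rw [hlog n hn, ← mul_sub, mul_left_comm]
    exact mul_le_mul_of_nonneg_left (hker _ δ hδ).2 (hC n)

/-- `S_q ≥ 0` for `Cₙ, q ≥ 0`. [folklore] -/
theorem riesz_sum_nonneg (hC : ∀ n, 0 ≤ C n) (hq0 : ∀ u, 0 ≤ q u) (x : ℝ) :
    0 ≤ ∑ n ∈ Icc 1 ⌊x⌋₊, C n * q (Real.log (x / n)) :=
  Finset.sum_nonneg fun n _ ↦ mul_nonneg (hC n) (hq0 _)

/-- **One step of the descent** (`κ = 2`): if `|S_Q(x) - c x²| ≤ K x^θ` for `x ≥ 1` with `c ≥ 0`,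
`0 ≤ θ < 2`, then `|S_q(x) - 2c x²| ≤ (2c + 2(e² + 1)K + 2 e² c) x^{1 + θ/2}` for `x ≥ 1` — take
`δ = x^{-(2-θ)/2}/2` in `riesz_diff_bounds` and use `|e^{±2δ} - 1 ∓ 2δ| ≤ 4δ²`. [folklore] -/
theorem riesz_descent (hC : ∀ n, 0 ≤ C n) (hq : ∀ u, u < 0 → q u = 0) (hq0 : ∀ u, 0 ≤ q u)
    (hQ : ∀ u, u < 0 → Q u = 0)
    (hker : ∀ u : ℝ, ∀ δ : ℝ, 0 < δ → δ * q u ≤ Q (u + δ) - Q u ∧ Q (u + δ) - Q u ≤ δ * q (u + δ))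
    {c K θ : ℝ} (hc : 0 ≤ c) (hK : 0 ≤ K) (hθ0 : 0 ≤ θ) (hθ : θ < 2)
    (hyp : ∀ x : ℝ, 1 ≤ x → |(∑ n ∈ Icc 1 ⌊x⌋₊, C n * Q (Real.log (x / n))) - c * x ^ 2| ≤ K * x ^ θ) :
    ∀ x : ℝ, 1 ≤ x →
      |(∑ n ∈ Icc 1 ⌊x⌋₊, C n * q (Real.log (x / n))) - 2 * c * x ^ 2| ≤
        (2 * c + 2 * (Real.exp 2 + 1) * K + 2 * Real.exp 2 * c) * x ^ (1 + θ / 2) := by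
  intro x hx
  have hx0 : 0 < x := by linarith
  -- the increment `δ = x^{-(2-θ)/2}/2 ∈ (0, 1/2]`
  set δ : ℝ := x ^ (-((2 - θ) / 2)) / 2 with hδdef
  have hδ0 : 0 < δ := by positivity
  have hδ1 : δ ≤ 1 / 2 := by
    have : x ^ (-((2 - θ) / 2)) ≤ 1 := Real.rpow_le_one_of_one_le_of_nonpos hx (by linarith)
    rw [hδdef]; linarith
  have hx2r : x ^ (2 : ℕ) = x ^ (2 : ℝ) := by rw [← Real.rpow_natCast]; norm_num
  have hδx : δ * x ^ 2 = x ^ (1 + θ / 2) / 2 := by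
    rw [hδdef, hx2r, div_mul_eq_mul_div, ← Real.rpow_add hx0]; congr 2; ring
  have hδx' : x ^ θ / δ = 2 * x ^ (1 + θ / 2) := by
    rw [hδdef, Real.rpow_neg hx0.le, ← div_mul, div_inv_eq_mul, ← Real.rpow_add hx0,
      show θ + (2 - θ) / 2 = 1 + θ / 2 by ring]
    ring
  have hx1p : (1 : ℝ) ≤ x ^ (1 + θ / 2) := Real.one_le_rpow hx (by linarith)
  have hxp : 0 ≤ x ^ (1 + θ / 2) := by positivity
  -- exponential increments
  have he2 : |Real.exp (2 * δ) - 1 - 2 * δ| ≤ (2 * δ) ^ 2 :=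
    Real.abs_exp_sub_one_sub_id_le (by rw [abs_of_pos (by linarith)]; linarith)
  have he2' : |Real.exp (-(2 * δ)) - 1 - -(2 * δ)| ≤ (-(2 * δ)) ^ 2 :=
    Real.abs_exp_sub_one_sub_id_le (by rw [abs_neg, abs_of_pos (by linarith)]; linarith)
  set Sq : ℝ → ℝ := fun y ↦ ∑ n ∈ Icc 1 ⌊y⌋₊, C n * q (Real.log (y / n)) with hSq
  set SQ : ℝ → ℝ := fun y ↦ ∑ n ∈ Icc 1 ⌊y⌋₊, C n * Q (Real.log (y / n)) with hSQ
  have hSq0 : ∀ y, 0 ≤ Sq y := fun y ↦ riesz_sum_nonneg hC hq0 y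
  have hA : ∀ y : ℝ, 1 ≤ y → SQ y ≤ c * y ^ 2 + K * y ^ θ ∧ c * y ^ 2 - K * y ^ θ ≤ SQ y := by
    intro y hy
    have h := abs_le.mp (hyp y hy)
    exact ⟨by linarith [h.2], by linarith [h.1]⟩
  -- upper bound via `S_Q(x e^δ) - S_Q(x) ≥ δ S_q(x)`
  have hup : Sq x - 2 * c * x ^ 2 ≤ (2 * c + 2 * (Real.exp 2 + 1) * K) * x ^ (1 + θ / 2) := by
    have h1 := (riesz_diff_bounds (q := q) (Q := Q) hC hq hQ hker hx0 hδ0).1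
    change δ * Sq x ≤ SQ (x * Real.exp δ) - SQ x at h1
    have hxe1 : 1 ≤ x * Real.exp δ := by
      have := Real.one_le_exp hδ0.le; nlinarith
    have hAe := (hA _ hxe1).1
    have hAx := (hA x hx).2
    have hpowθ : (x * Real.exp δ) ^ θ ≤ Real.exp 2 * x ^ θ := by
      rw [Real.mul_rpow hx0.le (Real.exp_pos δ).le, mul_comm]
      refine mul_le_mul_of_nonneg_right ?_ (Real.rpow_nonneg hx0.le _)
      rw [← Real.exp_mul]
      exact Real.exp_le_exp.mpr (by nlinarith)
    have hsq : (x * Real.exp δ) ^ 2 = x ^ 2 * Real.exp (2 * δ) := by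
      rw [mul_pow, ← Real.exp_nat_mul]; norm_num
    have he : Real.exp (2 * δ) - 1 ≤ 2 * δ + 4 * δ ^ 2 := by
      have := (abs_le.mp he2).2; nlinarith
    have hcx : 0 ≤ c * x ^ 2 := by positivity
    have h2 : δ * Sq x ≤ c * x ^ 2 * (2 * δ + 4 * δ ^ 2) + K * (Real.exp 2 + 1) * x ^ θ := by
      calc δ * Sq x ≤ SQ (x * Real.exp δ) - SQ x := h1
        _ ≤ (c * (x * Real.exp δ) ^ 2 + K * (x * Real.exp δ) ^ θ) - (c * x ^ 2 - K * x ^ θ) := by linarith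
        _ = c * x ^ 2 * (Real.exp (2 * δ) - 1) + K * (x * Real.exp δ) ^ θ + K * x ^ θ := by rw [hsq]; ring
        _ ≤ c * x ^ 2 * (2 * δ + 4 * δ ^ 2) + K * (Real.exp 2 * x ^ θ) + K * x ^ θ := by gcongr
        _ = c * x ^ 2 * (2 * δ + 4 * δ ^ 2) + K * (Real.exp 2 + 1) * x ^ θ := by ring
    -- divide by `δ`: `Sq x ≤ 2c x² + 4c (δ x²) + K (e²+1) (x^θ/δ)`
    have h3 : Sq x ≤ 2 * c * x ^ 2 + 4 * c * (δ * x ^ 2) + K * (Real.exp 2 + 1) * (x ^ θ / δ) := by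
      have hxθδ : K * (Real.exp 2 + 1) * x ^ θ = δ * (K * (Real.exp 2 + 1) * (x ^ θ / δ)) := by
        field_simp
      have h2' : δ * Sq x ≤ δ * (2 * c * x ^ 2 + 4 * c * (δ * x ^ 2) + K * (Real.exp 2 + 1) * (x ^ θ / δ)) := by
        calc δ * Sq x ≤ c * x ^ 2 * (2 * δ + 4 * δ ^ 2) + K * (Real.exp 2 + 1) * x ^ θ := h2
          _ = δ * (2 * c * x ^ 2 + 4 * c * (δ * x ^ 2)) + K * (Real.exp 2 + 1) * x ^ θ := by ring
          _ = δ * (2 * c * x ^ 2 + 4 * c * (δ * x ^ 2) + K * (Real.exp 2 + 1) * (x ^ θ / δ)) := by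
              rw [hxθδ]; ring
      exact le_of_mul_le_mul_left h2' hδ0
    rw [hδx, hδx'] at h3
    linarith
  -- lower bound
  have hlow : 2 * c * x ^ 2 - Sq x ≤ (2 * c + 4 * K + 2 * Real.exp 2 * c) * x ^ (1 + θ / 2) := by
    rcases le_or_gt x (Real.exp 1) with hxe | hxe
    · -- small `x`: `Sq ≥ 0` and `x² ≤ e²`
      have h0 := hSq0 x
      have hx2e : x ^ 2 ≤ Real.exp 2 := by
        have : Real.exp 1 * Real.exp 1 = Real.exp 2 := by rw [← Real.exp_add]; norm_num
        nlinarith [Real.exp_pos 1]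
      have h1 : 2 * c * x ^ 2 ≤ 2 * Real.exp 2 * c * x ^ (1 + θ / 2) := by
        calc 2 * c * x ^ 2 ≤ 2 * c * Real.exp 2 := by gcongr
          _ = 2 * Real.exp 2 * c * 1 := by ring
          _ ≤ 2 * Real.exp 2 * c * x ^ (1 + θ / 2) := by gcongr
      have hrest : 0 ≤ (2 * c + 4 * K) * x ^ (1 + θ / 2) := by positivity
      linarith
    · -- large `x`: compare with `y = x e^{-δ} ≥ 1`
      set y : ℝ := x * Real.exp (-δ) with hy
      have hy0 : 0 < y := by positivity
      have hy1 : 1 ≤ y := by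
        have h1 : Real.exp (-1) ≤ Real.exp (-δ) := Real.exp_le_exp.mpr (by linarith)
        have h2 : Real.exp 1 * Real.exp (-1) = 1 := by rw [← Real.exp_add]; norm_num
        have h3 : 0 < Real.exp (-1) := Real.exp_pos _
        calc (1 : ℝ) = Real.exp 1 * Real.exp (-1) := h2.symm
          _ ≤ x * Real.exp (-δ) := mul_le_mul hxe.le h1 h3.le hx0.le
      have hyx : y * Real.exp δ = x := by
        rw [hy, mul_assoc, ← Real.exp_add]; norm_num
      have hylex : y ≤ x := by
        rw [hy]; exact mul_le_of_le_one_right hx0.le (Real.exp_le_one_iff.mpr (by linarith))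
      have h1 := (riesz_diff_bounds (q := q) (Q := Q) hC hq hQ hker hy0 hδ0).2
      rw [hyx] at h1
      change SQ x - SQ y ≤ δ * Sq x at h1
      have hAy := (hA y hy1).1
      have hAx := (hA x hx).2
      have hyθ : y ^ θ ≤ x ^ θ := Real.rpow_le_rpow hy0.le hylex hθ0
      have hysq : y ^ 2 = x ^ 2 * Real.exp (-(2 * δ)) := by
        rw [hy, mul_pow, ← Real.exp_nat_mul]; ring_nf
      have he : 2 * δ - 4 * δ ^ 2 ≤ 1 - Real.exp (-(2 * δ)) := by
        have := (abs_le.mp he2').2; nlinarith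
      have hcx : 0 ≤ c * x ^ 2 := by positivity
      have hKy : K * y ^ θ ≤ K * x ^ θ := mul_le_mul_of_nonneg_left hyθ hK
      have hce : c * x ^ 2 * (2 * δ - 4 * δ ^ 2) ≤ c * x ^ 2 * (1 - Real.exp (-(2 * δ))) :=
        mul_le_mul_of_nonneg_left he hcx
      have h2 : c * x ^ 2 * (2 * δ - 4 * δ ^ 2) - 2 * K * x ^ θ ≤ δ * Sq x := by
        calc c * x ^ 2 * (2 * δ - 4 * δ ^ 2) - 2 * K * x ^ θ
            ≤ c * x ^ 2 * (1 - Real.exp (-(2 * δ))) - (K * x ^ θ + K * y ^ θ) := by linarith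
          _ = (c * x ^ 2 - K * x ^ θ) - (c * y ^ 2 + K * y ^ θ) := by rw [hysq]; ring
          _ ≤ SQ x - SQ y := by linarith
          _ ≤ δ * Sq x := h1
      have h3 : 2 * c * x ^ 2 - 4 * c * (δ * x ^ 2) - 2 * K * (x ^ θ / δ) ≤ Sq x := by
        have hxθδ : 2 * K * x ^ θ = δ * (2 * K * (x ^ θ / δ)) := by field_simp
        have h2' : δ * (2 * c * x ^ 2 - 4 * c * (δ * x ^ 2) - 2 * K * (x ^ θ / δ)) ≤ δ * Sq x := by
          calc δ * (2 * c * x ^ 2 - 4 * c * (δ * x ^ 2) - 2 * K * (x ^ θ / δ))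
              = δ * (2 * c * x ^ 2 - 4 * c * (δ * x ^ 2)) - δ * (2 * K * (x ^ θ / δ)) := by ring
            _ = c * x ^ 2 * (2 * δ - 4 * δ ^ 2) - 2 * K * x ^ θ := by rw [← hxθδ]; ring
            _ ≤ δ * Sq x := h2
        exact le_of_mul_le_mul_left h2' hδ0
      rw [hδx, hδx'] at h3
      have hrest : 0 ≤ 2 * Real.exp 2 * c * x ^ (1 + θ / 2) := by positivity
      linarith
  -- combine
  have hK' : (2 * c + 2 * (Real.exp 2 + 1) * K) * x ^ (1 + θ / 2) ≤
      (2 * c + 2 * (Real.exp 2 + 1) * K + 2 * Real.exp 2 * c) * x ^ (1 + θ / 2) := by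
    apply mul_le_mul_of_nonneg_right _ hxp
    have := Real.exp_pos 2; nlinarith
  have hK'' : (2 * c + 4 * K + 2 * Real.exp 2 * c) * x ^ (1 + θ / 2) ≤
      (2 * c + 2 * (Real.exp 2 + 1) * K + 2 * Real.exp 2 * c) * x ^ (1 + θ / 2) := by
    apply mul_le_mul_of_nonneg_right _ hxp
    have : (1 : ℝ) ≤ Real.exp 2 := Real.one_le_exp (by norm_num)
    nlinarith
  rw [abs_le]
  change Sq x - 2 * c * x ^ 2 ≤ _ at hup
  change 2 * c * x ^ 2 - Sq x ≤ _ at hlow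
  constructor <;> linarith

end Sums




/-! ### The kernels `p_j`, the iterated descent, and the coefficient bound -/

section Iterate

variable {C : ℕ → ℝ}

/-- On the range `1 ≤ n ≤ ⌊x⌋` one has `log(x/n) ≥ 0`. [folklore] -/
theorem log_div_nonneg_of_mem_Icc {x : ℝ} (hx : 0 < x) {n : ℕ} (hn : n ∈ Icc 1 ⌊x⌋₊) :
    0 ≤ Real.log (x / n) := by
  rw [Finset.mem_Icc] at hn
  have hn0 : (0 : ℝ) < n := by exact_mod_cast hn.1
  have hnx : (n : ℝ) ≤ x := (Nat.cast_le.mpr hn.2).trans (Nat.floor_le hx.le)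
  exact Real.log_nonneg ((one_le_div hn0).mpr hnx)

/-- The kernel sum of order `j ≥ 1` is the logarithmic Riesz mean `Σ_{n ≤ x} Cₙ (log x/n)ʲ/j!`.
[folklore] -/
theorem sum_kernel_eq_riesz {x : ℝ} (hx : 0 < x) {j : ℕ} (hj : 1 ≤ j) :
    ∑ n ∈ Icc 1 ⌊x⌋₊, C n *
        (if j = 0 then (if 0 ≤ Real.log (x / n) then 1 else 0)
          else (max (Real.log (x / n)) 0) ^ j / j.factorial) =
      ∑ n ∈ Icc 1 ⌊x⌋₊, C n * (Real.log (x / n)) ^ j / j.factorial := by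
  refine Finset.sum_congr rfl fun n hn ↦ ?_
  rw [if_neg (by omega), max_eq_left (log_div_nonneg_of_mem_Icc hx hn), mul_div_assoc]

/-- The kernel sum of order `0` is the partial sum `Σ_{n ≤ x} Cₙ`. [folklore] -/
theorem sum_kernel_zero_eq_partialSum {x : ℝ} (hx : 0 < x) :
    ∑ n ∈ Icc 1 ⌊x⌋₊, C n *
        (if (0 : ℕ) = 0 then (if 0 ≤ Real.log (x / n) then 1 else 0)
          else (max (Real.log (x / n)) 0) ^ 0 / (0 : ℕ).factorial) =
      ∑ n ∈ Icc 1 ⌊x⌋₊, C n := by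
  refine Finset.sum_congr rfl fun n hn ↦ ?_
  rw [if_pos rfl, if_pos (log_div_nonneg_of_mem_Icc hx hn), mul_one]

/-- **The iterated descent**: a power saving `|S_m(x) - c x²| ≤ K x^θ` (`x ≥ 1`, `c ≥ 0`,
`0 ≤ θ < 2`) for the kernel sum of order `m` gives, for every `i ≤ m`, a power saving
`|S_{m-i}(x) - 2ⁱ c x²| ≤ K_i x^{2 - (2-θ)/2ⁱ}` for the kernel sum of order `m - i`. [folklore] -/
theorem riesz_descent_iter (hC : ∀ n, 0 ≤ C n) {m : ℕ} {c K θ : ℝ} (hc : 0 ≤ c) (hK : 0 ≤ K)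
    (hθ0 : 0 ≤ θ) (hθ : θ < 2)
    (hyp : ∀ x : ℝ, 1 ≤ x →
      |(∑ n ∈ Icc 1 ⌊x⌋₊, C n *
          (if m = 0 then (if 0 ≤ Real.log (x / n) then 1 else 0)
            else (max (Real.log (x / n)) 0) ^ m / m.factorial)) - c * x ^ 2| ≤ K * x ^ θ) :
    ∀ i : ℕ, i ≤ m → ∃ K' : ℝ, 0 ≤ K' ∧ ∀ x : ℝ, 1 ≤ x →
      |(∑ n ∈ Icc 1 ⌊x⌋₊, C n *
          (if m - i = 0 then (if 0 ≤ Real.log (x / n) then 1 else 0)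
            else (max (Real.log (x / n)) 0) ^ (m - i) / (m - i).factorial)) - 2 ^ i * c * x ^ 2| ≤
        K' * x ^ (2 - (2 - θ) / 2 ^ i) := by
  intro i
  induction i with
  | zero =>
    intro _
    refine ⟨K, hK, fun x hx ↦ ?_⟩
    have h := hyp x hx
    simp only [Nat.sub_zero, pow_zero, one_mul]
    rwa [show (2 : ℝ) - (2 - θ) / 1 = θ by ring]
  | succ i ih =>
    intro hi
    obtain ⟨K', hK'0, hK'⟩ := ih (by omega)
    -- one descent step from order `m - i ≥ 1` to order `m - (i+1)`
    set j : ℕ := m - i with hj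
    have hj1 : 1 ≤ j := by omega
    have hjm : m - (i + 1) = j - 1 := by omega
    set θi : ℝ := 2 - (2 - θ) / 2 ^ i with hθi
    have h2i : (0 : ℝ) < 2 ^ i := by positivity
    have hθi0 : 0 ≤ θi := by
      rw [hθi, sub_nonneg, div_le_iff₀ h2i]
      have : (1 : ℝ) ≤ 2 ^ i := one_le_pow₀ (by norm_num)
      nlinarith
    have hθi2 : θi < 2 := by
      rw [hθi]; have : 0 < (2 - θ) / 2 ^ i := by positivity
      linarith
    have hci : 0 ≤ 2 ^ i * c := by positivity
    have hstep := riesz_descent (C := C)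
      (q := fun u ↦ if j - 1 = 0 then (if 0 ≤ u then 1 else 0) else (max u 0) ^ (j - 1) / (j - 1).factorial)
      (Q := fun u ↦ if j = 0 then (if 0 ≤ u then 1 else 0) else (max u 0) ^ j / j.factorial)
      hC ?_ ?_ ?_ ?_ hci hK'0 hθi0 hθi2 ?_
    · refine ⟨2 * (2 ^ i * c) + 2 * (Real.exp 2 + 1) * K' + 2 * Real.exp 2 * (2 ^ i * c), by positivity,
        fun x hx ↦ ?_⟩
      have h := hstep x hx
      rw [hjm]
      have e1 : (2 : ℝ) ^ (i + 1) * c = 2 * (2 ^ i * c) := by ring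
      have e2 : (2 : ℝ) - (2 - θ) / 2 ^ (i + 1) = 1 + θi / 2 := by
        rw [hθi, pow_succ]; field_simp; ring
      rw [e1, e2]
      exact h
    · -- support of `q`
      intro u hu
      show (if j - 1 = 0 then (if 0 ≤ u then (1 : ℝ) else 0) else (max u 0) ^ (j - 1) / (j - 1).factorial) = 0
      split_ifs with h1 h2
      · exact absurd h2 (not_le.mpr hu)
      · rfl
      · rw [max_eq_right hu.le, zero_pow h1, zero_div]
    · -- `q ≥ 0`
      intro u
      show 0 ≤ (if j - 1 = 0 then (if 0 ≤ u then (1 : ℝ) else 0) else (max u 0) ^ (j - 1) / (j - 1).factorial)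
      split_ifs <;> positivity
    · -- support of `Q`
      intro u hu
      show (if j = 0 then (if 0 ≤ u then (1 : ℝ) else 0) else (max u 0) ^ j / j.factorial) = 0
      rw [if_neg (by omega), max_eq_right hu.le, zero_pow (by omega), zero_div]
    · -- the kernel increments
      intro u δ hδ
      have h := kernel_diff_bounds j hj1 u hδ
      simp only [if_neg (show j ≠ 0 by omega)]
      exact h
    · -- the hypothesis at order `j = m - i`
      intro x hx
      exact hK' x hx

/-- **From partial sums to coefficients**: if `Cₙ ≥ 0` and `|Σ_{n ≤ x} Cₙ - c x²| ≤ K x^θ₀` for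
`x ≥ 1` with `c ≥ 0`, `1 ≤ θ₀`, then `Cₙ ≤ (2c + 2K) n^θ₀` for all `n ≥ 1`. [folklore] -/
theorem coeff_le_of_partialSum {c K θ₀ : ℝ} (hc : 0 ≤ c) (hK : 0 ≤ K) (hθ₀ : 1 ≤ θ₀)
    (hyp : ∀ x : ℝ, 1 ≤ x → |(∑ n ∈ Icc 1 ⌊x⌋₊, C n) - c * x ^ 2| ≤ K * x ^ θ₀)
    {n : ℕ} (hn : 1 ≤ n) : C n ≤ (2 * c + 2 * K) * (n : ℝ) ^ θ₀ := by
  have hn0 : (0 : ℝ) < n := by exact_mod_cast hn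
  have hn1 : (1 : ℝ) ≤ n := by exact_mod_cast hn
  have hnpow : (n : ℝ) ≤ (n : ℝ) ^ θ₀ := by
    calc (n : ℝ) = (n : ℝ) ^ (1 : ℝ) := (Real.rpow_one _).symm
      _ ≤ (n : ℝ) ^ θ₀ := Real.rpow_le_rpow_of_exponent_le hn1 hθ₀
  have h1pow : (1 : ℝ) ≤ (n : ℝ) ^ θ₀ := hn1.trans hnpow
  have hTn := (abs_le.mp (hyp n hn1)).2
  rw [Nat.floor_natCast] at hTn
  rcases Nat.lt_or_ge n 2 with hlt | hge
  · have hneq : n = 1 := by omega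
    subst hneq
    simp only [Nat.cast_one, one_pow, mul_one, Finset.Icc_self, Finset.sum_singleton, Real.one_rpow] at hTn ⊢
    linarith
  · have hTm := (abs_le.mp (hyp (n - 1 : ℕ) (by
      have : (1 : ℝ) ≤ ((n - 1 : ℕ) : ℝ) := by exact_mod_cast (by omega : 1 ≤ n - 1)
      exact this))).1
    rw [Nat.floor_natCast] at hTm
    have hsplit : ∑ k ∈ Icc 1 n, C k = (∑ k ∈ Icc 1 (n - 1), C k) + C n := by
      rw [show n = (n - 1) + 1 from by omega, Finset.sum_Icc_succ_top (by omega), Nat.sub_add_cancel (by omega)]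
    have hcast : ((n - 1 : ℕ) : ℝ) = n - 1 := by
      rw [Nat.cast_sub (by omega)]; norm_num
    rw [hcast] at hTm
    have hpm : ((n : ℝ) - 1) ^ θ₀ ≤ (n : ℝ) ^ θ₀ := Real.rpow_le_rpow (by linarith) (by linarith) (by linarith)
    have hKm : K * ((n : ℝ) - 1) ^ θ₀ ≤ K * (n : ℝ) ^ θ₀ := mul_le_mul_of_nonneg_left hpm hK
    -- `C n = T(n) - T(n-1) ≤ c (2n - 1) + 2 K n^θ₀`
    have hCn : C n ≤ c * (2 * n - 1) + 2 * K * (n : ℝ) ^ θ₀ := by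
      have e : C n = (∑ k ∈ Icc 1 n, C k) - ∑ k ∈ Icc 1 (n - 1), C k := by rw [hsplit]; ring
      rw [e]
      nlinarith
    calc C n ≤ c * (2 * n - 1) + 2 * K * (n : ℝ) ^ θ₀ := hCn
      _ ≤ c * (2 * (n : ℝ) ^ θ₀) + 2 * K * (n : ℝ) ^ θ₀ := by
          have : c * (2 * n - 1) ≤ c * (2 * (n : ℝ) ^ θ₀) := mul_le_mul_of_nonneg_left (by linarith) hc
          linarith
      _ = (2 * c + 2 * K) * (n : ℝ) ^ θ₀ := by ring

end Iterate

end Literature.Analysis.Complex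

end
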